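import Mathlib

/-!
# Small-hopping diamagnetism (stmt-QuantumFields-9738): the `log det` expansion

Helper file for the support item `SmallHoppingDiamagnetism` of route `QuarksAsStableAction`:
the convergent expansion `log |det (1 - t A)| = - Re Σ_{k ≥ 1} tᵏ tr(Aᵏ) / k` for a complex
square matrix all of whose characteristic roots have modulus `≤ R`, `0 ≤ t`, `t R < 1`
(`log_norm_det_one_sub_smul`), the termwise bound `‖tᵏ tr(Aᵏ)/k‖ ≤ card n · (tR)ᵏ / k`, and the
geometric tail estimate used to control loops of length `≥ L` (`norm_tsum_shift_le`).
The traces of powers enter through `trace_pow_eq_sum_roots_pow` of the sibling `…Spectral` file,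
restated here as a hypothesis-free import.  Mathlib only.
-/

namespace Summit.QuantumFields.QCD.Theorems.SmallHopping

open Polynomial

/-! ## Power series of `-log (1 - t z)` summed over a multiset of roots -/

/-- For a multiset `s` of complex numbers of modulus `≤ R` and `0 ≤ t`, `t R < 1`:
`Σ_k Σ_{z ∈ s} (t z)ᵏ / k = - Σ_{z ∈ s} log (1 - t z)` (the `k = 0` term is `0` by `x / 0 = 0`). -/
theorem hasSum_multiset_neg_log (s : Multiset ℂ) {R t : ℝ} (ht : 0 ≤ t) (htR : t * R < 1)
    (hs : ∀ z ∈ s, ‖z‖ ≤ R) :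
    HasSum (fun k : ℕ => (s.map fun z => ((t : ℂ) * z) ^ k / k).sum)
      (-(s.map fun z => Complex.log (1 - t * z)).sum) := by
  induction s using Multiset.induction_on with
  | empty => simp
  | cons a s ih =>
    have ha : ‖(t : ℂ) * a‖ < 1 := by
      rw [norm_mul, Complex.norm_real, Real.norm_of_nonneg ht]
      calc t * ‖a‖ ≤ t * R := mul_le_mul_of_nonneg_left (hs a (Multiset.mem_cons_self a s)) ht
        _ < 1 := htR
    have h1 := Complex.hasSum_taylorSeries_neg_log ha
    have h2 := ih (fun z hz => hs z (Multiset.mem_cons_of_mem hz))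
    have h3 := h1.add h2
    simp only [Multiset.map_cons, Multiset.sum_cons, neg_add]
    exact h3

/-- `1 - t z ≠ 0` when `‖z‖ ≤ R`, `0 ≤ t`, `t R < 1`. -/
theorem one_sub_mul_ne_zero {z : ℂ} {R t : ℝ} (ht : 0 ≤ t) (htR : t * R < 1) (hz : ‖z‖ ≤ R) :
    (1 : ℂ) - t * z ≠ 0 := by
  intro h
  have h1 : (t : ℂ) * z = 1 := by linear_combination -h
  have h2 : ‖(t : ℂ) * z‖ < 1 := by
    rw [norm_mul, Complex.norm_real, Real.norm_of_nonneg ht]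
    calc t * ‖z‖ ≤ t * R := mul_le_mul_of_nonneg_left hz ht
      _ < 1 := htR
  rw [h1, norm_one] at h2
  exact lt_irrefl _ h2

/-- `log |Π_{z ∈ s} (1 - t z)| = Re Σ_{z ∈ s} log (1 - t z)` and the product is nonzero. -/
theorem log_norm_multiset_prod (s : Multiset ℂ) {R t : ℝ} (ht : 0 ≤ t) (htR : t * R < 1)
    (hs : ∀ z ∈ s, ‖z‖ ≤ R) :
    (s.map fun z => (1 : ℂ) - t * z).prod ≠ 0 ∧
      Real.log ‖(s.map fun z => (1 : ℂ) - t * z).prod‖ =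
        ((s.map fun z => Complex.log (1 - t * z)).sum).re := by
  induction s using Multiset.induction_on with
  | empty => simp
  | cons a s ih =>
    obtain ⟨hne, hlog⟩ := ih (fun z hz => hs z (Multiset.mem_cons_of_mem hz))
    have ha : (1 : ℂ) - t * a ≠ 0 :=
      one_sub_mul_ne_zero ht htR (hs a (Multiset.mem_cons_self a s))
    simp only [Multiset.map_cons, Multiset.prod_cons, Multiset.sum_cons]
    refine ⟨mul_ne_zero ha hne, ?_⟩
    rw [norm_mul, Real.log_mul (norm_ne_zero_iff.mpr ha) (norm_ne_zero_iff.mpr hne), hlog,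
      Complex.add_re, Complex.log_re]

/-! ## The `log det` expansion -/

section Matrix

variable {n : Type*} [Fintype n] [DecidableEq n]

/-- **The `log det` expansion.**  If every characteristic root of the complex square matrix `A`
has modulus `≤ R`, `0 ≤ t` and `t R < 1`, then `det (1 - t A) ≠ 0`, the series
`Σ_k tᵏ tr(Aᵏ)/k` converges (the `k = 0` term being `0`), and
`log |det (1 - t A)| = - Re Σ_k tᵏ tr(Aᵏ)/k`.  (Proof: `det (1 - tA) = Π (1 - t λ)` and
`tr Aᵏ = Σ λᵏ` over the characteristic roots, plus the Taylor series of `-log (1 - w)`.)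
The hypothesis `htr` is `trace_pow_eq_sum_roots_pow A` of the sibling `…Spectral` file and
`hdet` is `det_one_sub_smul_eq_prod_roots A t` there. -/
theorem log_norm_det_one_sub_smul (A : Matrix n n ℂ) {R t : ℝ} (ht : 0 ≤ t) (htR : t * R < 1)
    (hR : ∀ z ∈ A.charpoly.roots, ‖z‖ ≤ R)
    (htr : ∀ k : ℕ, (A ^ k).trace = (A.charpoly.roots.map (· ^ k)).sum)
    (hdet : ((1 : Matrix n n ℂ) - (t : ℂ) • A).det =
      (A.charpoly.roots.map (fun z => 1 - (t : ℂ) * z)).prod) :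
    ((1 : Matrix n n ℂ) - (t : ℂ) • A).det ≠ 0 ∧
      Summable (fun k : ℕ => (t : ℂ) ^ k * (A ^ k).trace / k) ∧
      Real.log ‖((1 : Matrix n n ℂ) - (t : ℂ) • A).det‖ =
        -(∑' k : ℕ, (t : ℂ) ^ k * (A ^ k).trace / k).re := by
  have hsum := hasSum_multiset_neg_log A.charpoly.roots ht htR hR
  obtain ⟨hne, hlog⟩ := log_norm_multiset_prod A.charpoly.roots ht htR hR
  have hf : (fun k : ℕ => (t : ℂ) ^ k * (A ^ k).trace / k) =
      fun k : ℕ => (A.charpoly.roots.map fun z => ((t : ℂ) * z) ^ k / k).sum := by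
    funext k
    rw [htr k]
    have : (fun z : ℂ => ((t : ℂ) * z) ^ k / k) = fun z => (t : ℂ) ^ k / k * z ^ k := by
      funext z; rw [mul_pow]; ring
    rw [this, Multiset.sum_map_mul_left]
    ring
  rw [hdet, hf]
  refine ⟨hne, hsum.summable, ?_⟩
  rw [hsum.tsum_eq, hlog, Complex.neg_re, neg_neg]

/-- Termwise bound: if all characteristic roots have modulus `≤ R` and `0 ≤ t`, then
`‖tᵏ tr(Aᵏ)/k‖ ≤ card n · (t R)ᵏ / k` (given the trace bound `‖tr Aᵏ‖ ≤ card n · Rᵏ` of the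
sibling `…Spectral` file, `norm_trace_pow_le`). -/
theorem norm_term_le (A : Matrix n n ℂ) {R t : ℝ} (ht : 0 ≤ t)
    (htrace : ∀ k : ℕ, ‖(A ^ k).trace‖ ≤ Fintype.card n * R ^ k) (k : ℕ) :
    ‖(t : ℂ) ^ k * (A ^ k).trace / k‖ ≤ Fintype.card n * (t * R) ^ k / k := by
  rw [norm_div, norm_mul, norm_pow, Complex.norm_real, Real.norm_of_nonneg ht,
    Complex.norm_natCast, mul_pow]
  rcases Nat.eq_zero_or_pos k with rfl | hk
  · simp
  · rw [div_le_div_iff_of_pos_right (by exact_mod_cast hk)]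
    calc t ^ k * ‖(A ^ k).trace‖ ≤ t ^ k * (Fintype.card n * R ^ k) :=
          mul_le_mul_of_nonneg_left (htrace k) (pow_nonneg ht k)
      _ = Fintype.card n * (t ^ k * R ^ k) := by ring

end Matrix

/-! ## Geometric tails -/

/-- **Geometric tail estimate.**  If `‖f k‖ ≤ B rᵏ / k` for all `k` (`0 ≤ B`, `0 ≤ r < 1`), then
for `L ≥ 1` the shifted tail satisfies `‖Σ_k f (k + L)‖ ≤ (B / L) · r^L / (1 - r)`. -/
theorem norm_tsum_shift_le {f : ℕ → ℂ} {B r : ℝ} (hB : 0 ≤ B) (hr0 : 0 ≤ r) (hr1 : r < 1)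
    (hf : ∀ k : ℕ, ‖f k‖ ≤ B * r ^ k / k) {L : ℕ} (hL : 0 < L) :
    ‖∑' k : ℕ, f (k + L)‖ ≤ B / L * r ^ L / (1 - r) := by
  have hLr : (0 : ℝ) < L := by exact_mod_cast hL
  have hgeom : Summable fun k : ℕ => B / L * r ^ L * r ^ k :=
    (summable_geometric_of_lt_one hr0 hr1).mul_left _
  have hbound : ∀ k : ℕ, ‖f (k + L)‖ ≤ B / L * r ^ L * r ^ k := by
    intro k
    refine (hf (k + L)).trans ?_
    have hkL : (0 : ℝ) < (k + L : ℕ) := by positivity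
    rw [div_le_iff₀ hkL, pow_add]
    have h1 : (L : ℝ) ≤ (k + L : ℕ) := by push_cast; linarith
    have h2 : 0 ≤ B * (r ^ k * r ^ L) := mul_nonneg hB (mul_nonneg (pow_nonneg hr0 k) (pow_nonneg hr0 L))
    calc B * (r ^ k * r ^ L) = B / L * r ^ L * r ^ k * L := by field_simp
      _ ≤ B / L * r ^ L * r ^ k * (k + L : ℕ) := by
          apply mul_le_mul_of_nonneg_left h1
          have : 0 ≤ B / L * r ^ L * r ^ k := by positivity
          exact this
  have hsf : Summable fun k : ℕ => ‖f (k + L)‖ :=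
    Summable.of_nonneg_of_le (fun _ => norm_nonneg _) hbound hgeom
  calc ‖∑' k : ℕ, f (k + L)‖ ≤ ∑' k : ℕ, ‖f (k + L)‖ := norm_tsum_le_tsum_norm hsf
    _ ≤ ∑' k : ℕ, B / L * r ^ L * r ^ k := hsf.tsum_le_tsum hbound hgeom
    _ = B / L * r ^ L / (1 - r) := by
        rw [tsum_mul_left, tsum_geometric_of_lt_one hr0 hr1, div_eq_mul_inv, div_eq_mul_inv]

end Summit.QuantumFields.QCD.Theorems.SmallHopping
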